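import Mathlib
import Summits.ResolutionOfSingularities.ResolutionOfSingularities.Theorems.HomologicalConductorPersistenceKC3Completion
import HarnessLib

/-!
# K-C3 §H2L piece K2c in the `xy` coordinates of record: `k[x,y,z,t]/(xy − h) ≅ k[z,t,u,v]/(u² + v² − h)` over a field with
# `√−1`, and the K2-LOWER bound `(x, y, z², zt, t²)·L ⊆ ca(L)` at any local ring of the origin

Route `ResolutionOfSingularities/HomologicalConductor`, chain W4.4b (cell `res-hironaka`), crux `Persistence`
(stmt-ResolutionOfSingularities-16484), KILL CANDIDATE K-C3; res-L1-w44b-plan-1 KC3 SPELLING v1.1 (E′) (2026-08-27T12:00:59Z,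
adopting res-L1-w44b-tri-1's caveat 11:59:23Z): «the field of record contains `√−1` — binders `(i : k) (hi : i ^ 2 = -1)` consumed
only by K2-lower/K2c».  [OURS; AI-written, weaker than expert review; NOT a statement of the manuscript under study (Hironaka 2017).]

The K2c file proper (`…PersistenceKC3Completion`, p530272) works in the coordinates `(z,t,u,v)` of `A′ = k[z,t,u,v]/(u² + v² − h)` and
uses no square root of `−1`.  The chain's source is `A = k[x,y,z,t]/(xy − h)` (`h = z³ + t⁴`; indices `x,y,z,t = 0,1,2,3`, the
convention of res-D-pv-058's p527448 and res-type-010's p527657/p528919).  Here: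

* `xyEquiv` (inline) — the `k`-algebra isomorphism `φ : k[x,y,z,t] ≃ₐ k[z,t,u,v]`, `x ↦ u + iv`, `y ↦ u − iv`, `z ↦ z`, `t ↦ t`,
  inverse `u ↦ (x + y)/2`, `v ↦ (x − y)/(2i)` (`char k ≠ 2`, `i² = −1`), with `φ(xy − h(z,t)) = u² + v² − h(z,t)`
  (`exists_xyEquiv`);
* **`span_le_cohomologyAnnihilator_of_isLocalization_xy`** — for ANY local ring `L` of `A` at its origin `𝔬 = (x,y,z,t)·A`
  (`IsLocalization.AtPrime L 𝔬`), modulo [Esentepe2020, Thm. 5.4] (`hE`) and the curve-side identity `hca` (K2b):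
  **`(x, y, z², zt, t²)·L ⊆ ca(L)`** — the K2-LOWER half of the K-C3 centre in the chain's own coordinates
  (`span_le_cohomologyAnnihilator_of_isLocalization` of the K2c file, with `L` made an `A′`-algebra through `φ`;
  `IsLocalization.isLocalization_of_base_ringEquiv`; `((x+y)/2, (x−y)/(2i)) = (x, y)` as ideals).

Filed `--supports stmt-ResolutionOfSingularities-16484 --as helper`.  Reference: Ö. Esentepe, J. Algebra 541 (2020) [`Esentepe2020`].
-/

noncomputable section

-- single-problem summit: the doubled namespace component `ResolutionOfSingularities` is forced
set_option linter.dupNamespace false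

namespace Summit.ResolutionOfSingularities.ResolutionOfSingularities.Theorems.HomologicalConductor.PersistenceKC3Completion

open IsLocalRing Literature.RingTheory.CohomologyAnnihilator Literature.AlgebraicGeometry.Resolution

universe u

/-- The inclusion of indices `Fin 2 → Fin 4`, `0 ↦ 2` (`z`), `1 ↦ 3` (`t`), for the `xy` coordinates `(x,y,z,t) = (0,1,2,3)`. -/
def ztXY : Fin 2 → Fin 4 := fun j => Fin.natAdd 2 j

/-- The polynomial `xy − h(z,t) ∈ k[x,y,z,t]` of the chain's source (`h = hP` renamed into the last two variables). -/
def kc3PolyXY (k : Type u) [Field k] (hP : MvPolynomial (Fin 2) k) : MvPolynomial (Fin 4) k :=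
  MvPolynomial.X 0 * MvPolynomial.X 1 - MvPolynomial.rename ztXY hP

/-- The chain's source `A = k[x,y,z,t]/(xy − h)`. -/
abbrev KC3RingXY (k : Type u) [Field k] (hP : MvPolynomial (Fin 2) k) : Type u :=
  MvPolynomial (Fin 4) k ⧸ Ideal.span {kc3PolyXY k hP}

/-- Its origin `𝔬 = (x, y, z, t)·A`. -/
def kc3OriginXY (k : Type u) [Field k] (hP : MvPolynomial (Fin 2) k) : Ideal (KC3RingXY k hP) :=
  (originIdeal k 4).map (Ideal.Quotient.mk (Ideal.span {kc3PolyXY k hP}))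

/-! ## The linear change of coordinates `x = u + iv`, `y = u − iv` -/

section XY

variable (k : Type u) [Field k] (i : k) (hi : i ^ 2 = -1) (h2 : (2 : k) ≠ 0)

/-- Images of `x, y, z, t` in `k[z,t,u,v]`: `u + iv`, `u − iv`, `z`, `t`. -/
def xyFwd : Fin 4 → MvPolynomial (Fin 4) k :=
  ![MvPolynomial.X 2 + MvPolynomial.C i * MvPolynomial.X 3, MvPolynomial.X 2 - MvPolynomial.C i * MvPolynomial.X 3,
    MvPolynomial.X 0, MvPolynomial.X 1]

/-- Images of `z, t, u, v` in `k[x,y,z,t]`: `z`, `t`, `(x + y)/2`, `(x − y)/(2i)`. -/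
def xyBwd : Fin 4 → MvPolynomial (Fin 4) k :=
  ![MvPolynomial.X 2, MvPolynomial.X 3, MvPolynomial.C (2⁻¹ : k) * (MvPolynomial.X 0 + MvPolynomial.X 1),
    MvPolynomial.C ((2 * i)⁻¹ : k) * (MvPolynomial.X 0 - MvPolynomial.X 1)]

variable {k i}

/-- `φ x = u + iv`. -/
@[simp] theorem xyFwd_zero : xyFwd k i 0 = MvPolynomial.X 2 + MvPolynomial.C i * MvPolynomial.X 3 := rfl
/-- `φ y = u − iv`. -/
@[simp] theorem xyFwd_one : xyFwd k i 1 = MvPolynomial.X 2 - MvPolynomial.C i * MvPolynomial.X 3 := rfl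
/-- `φ z = z`. -/
@[simp] theorem xyFwd_two : xyFwd k i 2 = MvPolynomial.X 0 := rfl
/-- `φ t = t`. -/
@[simp] theorem xyFwd_three : xyFwd k i 3 = MvPolynomial.X 1 := rfl
/-- `φ⁻¹ z = z`. -/
@[simp] theorem xyBwd_zero : xyBwd k i 0 = MvPolynomial.X 2 := rfl
/-- `φ⁻¹ t = t`. -/
@[simp] theorem xyBwd_one : xyBwd k i 1 = MvPolynomial.X 3 := rfl
/-- `φ⁻¹ u = (x + y)/2`. -/
@[simp] theorem xyBwd_two :
    xyBwd k i 2 = MvPolynomial.C (2⁻¹ : k) * (MvPolynomial.X 0 + MvPolynomial.X 1) := rfl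
/-- `φ⁻¹ v = (x − y)/(2i)`. -/
@[simp] theorem xyBwd_three :
    xyBwd k i 3 = MvPolynomial.C ((2 * i)⁻¹ : k) * (MvPolynomial.X 0 - MvPolynomial.X 1) := rfl

include hi h2 in
/-- The coefficient identities `½ + i·(2i)⁻¹ = 1`, `½ − i·(2i)⁻¹ = 0`. [folklore] -/
theorem coeff_identities : (2⁻¹ + i * (2 * i)⁻¹ : k) = 1 ∧ (2⁻¹ - i * (2 * i)⁻¹ : k) = 0 := by
  have hi0 : i ≠ 0 := by rintro rfl; norm_num at hi
  constructor
  · field_simp; ring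
  · field_simp; ring

include hi h2 in
/-- `φ⁻¹ ∘ φ = id` on generators. [folklore] -/
theorem aeval_xyBwd_xyFwd (j : Fin 4) :
    MvPolynomial.aeval (xyBwd k i) (xyFwd k i j) = MvPolynomial.X j := by
  obtain ⟨hc1, hc0⟩ := coeff_identities hi h2
  fin_cases j
  · show MvPolynomial.aeval (xyBwd k i) (xyFwd k i 0) = MvPolynomial.X 0
    rw [xyFwd_zero, map_add, map_mul, MvPolynomial.aeval_X, MvPolynomial.aeval_X, MvPolynomial.aeval_C,
      MvPolynomial.algebraMap_eq, xyBwd_two, xyBwd_three]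
    have : (MvPolynomial.C (2⁻¹ : k) * (MvPolynomial.X 0 + MvPolynomial.X 1) +
        MvPolynomial.C i * (MvPolynomial.C ((2 * i)⁻¹ : k) * (MvPolynomial.X 0 - MvPolynomial.X 1)) : MvPolynomial (Fin 4) k) =
        MvPolynomial.C (2⁻¹ + i * (2 * i)⁻¹) * MvPolynomial.X 0 + MvPolynomial.C (2⁻¹ - i * (2 * i)⁻¹) * MvPolynomial.X 1 := by
      simp only [map_add, map_sub, map_mul]; ring
    rw [this, hc1, hc0, map_one, map_zero, one_mul, zero_mul, add_zero]
  · show MvPolynomial.aeval (xyBwd k i) (xyFwd k i 1) = MvPolynomial.X 1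
    rw [xyFwd_one, map_sub, map_mul, MvPolynomial.aeval_X, MvPolynomial.aeval_X, MvPolynomial.aeval_C,
      MvPolynomial.algebraMap_eq, xyBwd_two, xyBwd_three]
    have : (MvPolynomial.C (2⁻¹ : k) * (MvPolynomial.X 0 + MvPolynomial.X 1) -
        MvPolynomial.C i * (MvPolynomial.C ((2 * i)⁻¹ : k) * (MvPolynomial.X 0 - MvPolynomial.X 1)) : MvPolynomial (Fin 4) k) =
        MvPolynomial.C (2⁻¹ - i * (2 * i)⁻¹) * MvPolynomial.X 0 + MvPolynomial.C (2⁻¹ + i * (2 * i)⁻¹) * MvPolynomial.X 1 := by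
      simp only [map_add, map_sub, map_mul]; ring
    rw [this, hc1, hc0, map_one, map_zero, one_mul, zero_mul, zero_add]
  · show MvPolynomial.aeval (xyBwd k i) (xyFwd k i 2) = MvPolynomial.X 2
    rw [xyFwd_two, MvPolynomial.aeval_X, xyBwd_zero]
  · show MvPolynomial.aeval (xyBwd k i) (xyFwd k i 3) = MvPolynomial.X 3
    rw [xyFwd_three, MvPolynomial.aeval_X, xyBwd_one]

include hi h2 in
/-- `φ ∘ φ⁻¹ = id` on generators. [folklore] -/
theorem aeval_xyFwd_xyBwd (j : Fin 4) :
    MvPolynomial.aeval (xyFwd k i) (xyBwd k i j) = MvPolynomial.X j := by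
  have hi0 : i ≠ 0 := by rintro rfl; norm_num at hi
  fin_cases j
  · show MvPolynomial.aeval (xyFwd k i) (xyBwd k i 0) = MvPolynomial.X 0
    rw [xyBwd_zero, MvPolynomial.aeval_X, xyFwd_two]
  · show MvPolynomial.aeval (xyFwd k i) (xyBwd k i 1) = MvPolynomial.X 1
    rw [xyBwd_one, MvPolynomial.aeval_X, xyFwd_three]
  · show MvPolynomial.aeval (xyFwd k i) (xyBwd k i 2) = MvPolynomial.X 2
    rw [xyBwd_two, map_mul, map_add, MvPolynomial.aeval_X, MvPolynomial.aeval_X, MvPolynomial.aeval_C,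
      MvPolynomial.algebraMap_eq, xyFwd_zero, xyFwd_one]
    have : (MvPolynomial.C (2⁻¹ : k) * (MvPolynomial.X 2 + MvPolynomial.C i * MvPolynomial.X 3 +
        (MvPolynomial.X 2 - MvPolynomial.C i * MvPolynomial.X 3)) : MvPolynomial (Fin 4) k) =
        MvPolynomial.C (2⁻¹ : k) * 2 * MvPolynomial.X 2 := by
      ring
    rw [this, show (2 : MvPolynomial (Fin 4) k) = MvPolynomial.C 2 from (map_ofNat _ 2).symm, ← map_mul,
      inv_mul_cancel₀ h2, map_one, one_mul]
  · show MvPolynomial.aeval (xyFwd k i) (xyBwd k i 3) = MvPolynomial.X 3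
    rw [xyBwd_three, map_mul, map_sub, MvPolynomial.aeval_X, MvPolynomial.aeval_X, MvPolynomial.aeval_C,
      MvPolynomial.algebraMap_eq, xyFwd_zero, xyFwd_one]
    have : (MvPolynomial.C ((2 * i)⁻¹ : k) * (MvPolynomial.X 2 + MvPolynomial.C i * MvPolynomial.X 3 -
        (MvPolynomial.X 2 - MvPolynomial.C i * MvPolynomial.X 3)) : MvPolynomial (Fin 4) k) =
        MvPolynomial.C ((2 * i)⁻¹ : k) * (2 * MvPolynomial.C i) * MvPolynomial.X 3 := by
      ring
    rw [this, show (2 : MvPolynomial (Fin 4) k) = MvPolynomial.C 2 from (map_ofNat _ 2).symm, ← map_mul, ← map_mul,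
      inv_mul_cancel₀ (mul_ne_zero h2 hi0), map_one, one_mul]

include hi h2 in
/-- **The change of coordinates `φ : k[x,y,z,t] ≃ₐ k[z,t,u,v]`**, `x ↦ u + iv`, `y ↦ u − iv`, `z ↦ z`, `t ↦ t`, over a field with
`char k ≠ 2` containing `i = √−1`; it carries `xy − h(z,t)` to `u² + v² − h(z,t)` and the origin to the origin. [folklore] -/
theorem exists_xyEquiv (hP : MvPolynomial (Fin 2) k) :
    ∃ φ : MvPolynomial (Fin 4) k ≃ₐ[k] MvPolynomial (Fin 4) k,
      (∀ j, φ (MvPolynomial.X j) = xyFwd k i j) ∧ (∀ j, φ.symm (MvPolynomial.X j) = xyBwd k i j) ∧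
      φ (kc3PolyXY k hP) = kc3Poly k hP := by
  let φ : MvPolynomial (Fin 4) k ≃ₐ[k] MvPolynomial (Fin 4) k :=
    AlgEquiv.ofAlgHom (MvPolynomial.aeval (xyFwd k i)) (MvPolynomial.aeval (xyBwd k i))
      (MvPolynomial.algHom_ext fun j => by
        rw [AlgHom.comp_apply, MvPolynomial.aeval_X, AlgHom.id_apply]; exact aeval_xyFwd_xyBwd hi h2 j)
      (MvPolynomial.algHom_ext fun j => by
        rw [AlgHom.comp_apply, MvPolynomial.aeval_X, AlgHom.id_apply]; exact aeval_xyBwd_xyFwd hi h2 j)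
  have hφ : ∀ j, φ (MvPolynomial.X j) = xyFwd k i j := fun j => MvPolynomial.aeval_X _ j
  have hφs : ∀ j, φ.symm (MvPolynomial.X j) = xyBwd k i j := fun j => MvPolynomial.aeval_X _ j
  refine ⟨φ, hφ, hφs, ?_⟩
  -- `φ ∘ rename ztXY = rename zt` on `k[z,t]`
  have hren : (φ : MvPolynomial (Fin 4) k →ₐ[k] _).comp (MvPolynomial.rename ztXY) = MvPolynomial.rename zt := by
    refine MvPolynomial.algHom_ext fun j => ?_
    rw [AlgHom.comp_apply, MvPolynomial.rename_X, MvPolynomial.rename_X, AlgEquiv.coe_toAlgHom, hφ]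
    fin_cases j
    · exact xyFwd_two
    · exact xyFwd_three
  have hrenP : φ (MvPolynomial.rename ztXY hP) = MvPolynomial.rename zt hP := by
    have := congrArg (fun ψ => ψ hP) hren
    simpa only [AlgHom.comp_apply, AlgEquiv.coe_toAlgHom] using this
  rw [kc3PolyXY, map_sub, map_mul, hφ, hφ, hrenP, kc3Poly, xyFwd_zero, xyFwd_one]
  have hC : (MvPolynomial.C i * MvPolynomial.C i : MvPolynomial (Fin 4) k) = -1 := by
    rw [← map_mul, ← sq, hi, map_neg, map_one]
  linear_combination (MvPolynomial.X 3 ^ 2 : MvPolynomial (Fin 4) k) * (-hC)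

end XY

/-! ## K2-LOWER in the `xy` coordinates -/

/-- `u² + v² − h` and `xy − h` vanish at the origin together: the origin of `A` is maximal (when `h(0) = 0`). [folklore] -/
theorem kc3PolyXY_mem_originIdeal {k : Type u} [Field k] {hP : MvPolynomial (Fin 2) k}
    (h0 : MvPolynomial.constantCoeff hP = 0) : kc3PolyXY k hP ∈ originIdeal k 4 := by
  rw [mem_originIdeal_iff, kc3PolyXY, map_sub, map_mul, MvPolynomial.constantCoeff_X, MvPolynomial.constantCoeff_X,
    MvPolynomial.constantCoeff_rename, h0]
  norm_num

set_option maxHeartbeats 400000 in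
/-- **K2-LOWER IN THE CHAIN'S COORDINATES [OURS · K-C3 §H2L K2c, SPELLING v1.1 (E′)]:** for a field `k` with `char k ≠ 2`
containing `i` with `i² = −1`, a plane-curve polynomial `0 ≠ hP ∈ k[z,t]` with `hP(0) = 0`, and ANY local ring `L` of
`A = k[x,y,z,t]/(xy − h)` at its origin (`IsLocalization.AtPrime L 𝔬`): IF `ca(k⟦z,t⟧/(h)) = (z,t)²·(k⟦z,t⟧/(h))` (`hca`; K2b for
`h = z³ + t⁴`) THEN, modulo [Esentepe2020, Thm. 5.4] (`hE`), **`(x, y, z², zt, t²)·L ⊆ ca(L)`**.  Proof: `L` is a local ring of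
`A′ = k[z,t,u,v]/(u² + v² − h)` at ITS origin through `φ` (`exists_xyEquiv`, `Ideal.quotientEquiv`,
`IsLocalization.isLocalization_of_base_ringEquiv`), the K2c bound `(u, v, z², zt, t²)·L ⊆ ca(L)` applies
(`span_le_cohomologyAnnihilator_of_isLocalization`), and `((x+y)/2, (x−y)/(2i)) = (x, y)`.
[cite: Esentepe2020, Theorems 4.4 and 5.4 (consequence)] -/
theorem span_le_cohomologyAnnihilator_of_isLocalization_xy
    (hE : doubleBranchedCover_map_cohomologyAnnihilator_eq.{u}) (k : Type u) [Field k] (hchar : ringChar k ≠ 2)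
    (i : k) (hi : i ^ 2 = -1)
    (hP : MvPolynomial (Fin 2) k) (h0 : MvPolynomial.constantCoeff hP = 0) (hP0 : hP ≠ 0)
    (hca : cohomologyAnnihilator (MvPowerSeries (Fin 2) k ⧸ Ideal.span {(hP : MvPowerSeries (Fin 2) k)}) =
      ((Ideal.span {(MvPowerSeries.X 0 : MvPowerSeries (Fin 2) k), MvPowerSeries.X 1}) ^ 2).map
        (Ideal.Quotient.mk (Ideal.span {(hP : MvPowerSeries (Fin 2) k)})))
    (L : Type u) [CommRing L] [IsLocalRing L] [Algebra (KC3RingXY k hP) L] [(kc3OriginXY k hP).IsPrime]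
    [IsLocalization.AtPrime L (kc3OriginXY k hP)] :
    Ideal.span {algebraMap (KC3RingXY k hP) L (Ideal.Quotient.mk _ (MvPolynomial.X 0)),
        algebraMap (KC3RingXY k hP) L (Ideal.Quotient.mk _ (MvPolynomial.X 1)),
        algebraMap (KC3RingXY k hP) L (Ideal.Quotient.mk _ (MvPolynomial.X 2 ^ 2)),
        algebraMap (KC3RingXY k hP) L (Ideal.Quotient.mk _ (MvPolynomial.X 2 * MvPolynomial.X 3)),
        algebraMap (KC3RingXY k hP) L (Ideal.Quotient.mk _ (MvPolynomial.X 3 ^ 2))} ≤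
      cohomologyAnnihilator L := by
  have h2 : (2 : k) ≠ 0 := Ring.two_ne_zero hchar
  obtain ⟨φ, hφ, hφs, hφf⟩ := exists_xyEquiv hi h2 hP
  -- the underlying ring isomorphism and the induced isomorphism of the quotients `ψ : A ≃+* A′`
  let φr : MvPolynomial (Fin 4) k ≃+* MvPolynomial (Fin 4) k := φ.toRingEquiv
  have hφr : ∀ p, φr p = φ p := fun _ => rfl
  have hφrs : ∀ p, φr.symm p = φ.symm p := fun _ => rfl
  have hIJ : Ideal.span {kc3Poly k hP} =
      (Ideal.span {kc3PolyXY k hP}).map (φr : MvPolynomial (Fin 4) k →+* MvPolynomial (Fin 4) k) := by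
    rw [Ideal.map_span, Set.image_singleton, RingHom.coe_coe, hφr, hφf]
  let ψ : KC3RingXY k hP ≃+* KC3Ring k hP :=
    Ideal.quotientEquiv (Ideal.span {kc3PolyXY k hP}) (Ideal.span {kc3Poly k hP}) φr hIJ
  have hψ : ∀ p, ψ (Ideal.Quotient.mk _ p) = Ideal.Quotient.mk _ (φ p) := fun p =>
    Ideal.quotientEquiv_mk _ _ φr hIJ p
  have hψs : ∀ p, ψ.symm (Ideal.Quotient.mk _ p) = Ideal.Quotient.mk _ (φ.symm p) := fun p =>
    Ideal.quotientEquiv_symm_mk _ _ φr hIJ p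
  -- `ψ` carries the origin to the origin
  have hφ0 : ∀ p : MvPolynomial (Fin 4) k, p ∈ originIdeal k 4 → φ p ∈ originIdeal k 4 := by
    intro p hp
    rw [mem_originIdeal_iff] at hp ⊢
    -- `constantCoeff ∘ φ = constantCoeff` (both kill the variables)
    have hcomp : (MvPolynomial.constantCoeff : MvPolynomial (Fin 4) k →+* k).comp (φ : MvPolynomial (Fin 4) k →+* _) =
        MvPolynomial.constantCoeff := by
      refine MvPolynomial.ringHom_ext (fun a => ?_) (fun j => ?_)
      · change MvPolynomial.constantCoeff (φ (algebraMap k _ a)) = _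
        rw [AlgEquiv.commutes, MvPolynomial.algebraMap_eq, MvPolynomial.constantCoeff_C]
      · rw [RingHom.comp_apply, RingHom.coe_coe, hφ, MvPolynomial.constantCoeff_X]
        fin_cases j
        · show MvPolynomial.constantCoeff (xyFwd k i 0) = 0
          rw [xyFwd_zero, map_add, map_mul, MvPolynomial.constantCoeff_X, MvPolynomial.constantCoeff_X, mul_zero, add_zero]
        · show MvPolynomial.constantCoeff (xyFwd k i 1) = 0
          rw [xyFwd_one, map_sub, map_mul, MvPolynomial.constantCoeff_X, MvPolynomial.constantCoeff_X, mul_zero, sub_zero]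
        · show MvPolynomial.constantCoeff (xyFwd k i 2) = 0
          rw [xyFwd_two, MvPolynomial.constantCoeff_X]
        · show MvPolynomial.constantCoeff (xyFwd k i 3) = 0
          rw [xyFwd_three, MvPolynomial.constantCoeff_X]
    have := congrArg (fun g => g p) hcomp
    simp only [RingHom.comp_apply, RingHom.coe_coe] at this
    rw [this, hp]
  have hφs0 : ∀ p : MvPolynomial (Fin 4) k, p ∈ originIdeal k 4 → φ.symm p ∈ originIdeal k 4 := by
    intro p hp
    rw [mem_originIdeal_iff] at hp ⊢
    have hcomp : (MvPolynomial.constantCoeff : MvPolynomial (Fin 4) k →+* k).comp (φ.symm : MvPolynomial (Fin 4) k →+* _) =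
        MvPolynomial.constantCoeff := by
      refine MvPolynomial.ringHom_ext (fun a => ?_) (fun j => ?_)
      · change MvPolynomial.constantCoeff (φ.symm (algebraMap k _ a)) = _
        rw [AlgEquiv.commutes, MvPolynomial.algebraMap_eq, MvPolynomial.constantCoeff_C]
      · rw [RingHom.comp_apply, RingHom.coe_coe, hφs, MvPolynomial.constantCoeff_X]
        fin_cases j
        · show MvPolynomial.constantCoeff (xyBwd k i 0) = 0
          rw [xyBwd_zero, MvPolynomial.constantCoeff_X]
        · show MvPolynomial.constantCoeff (xyBwd k i 1) = 0
          rw [xyBwd_one, MvPolynomial.constantCoeff_X]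
        · show MvPolynomial.constantCoeff (xyBwd k i 2) = 0
          rw [xyBwd_two, map_mul, map_add, MvPolynomial.constantCoeff_X, MvPolynomial.constantCoeff_X, add_zero, mul_zero]
        · show MvPolynomial.constantCoeff (xyBwd k i 3) = 0
          rw [xyBwd_three, map_mul, map_sub, MvPolynomial.constantCoeff_X, MvPolynomial.constantCoeff_X, sub_zero, mul_zero]
    have := congrArg (fun g => g p) hcomp
    simp only [RingHom.comp_apply, RingHom.coe_coe] at this
    rw [this, hp]
  have hO : (kc3OriginXY k hP).map (ψ : KC3RingXY k hP →+* KC3Ring k hP) = kc3Origin k hP := by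
    apply le_antisymm
    · rw [kc3OriginXY, Ideal.map_map, Ideal.map_le_iff_le_comap]
      intro p hp
      rw [Ideal.mem_comap, RingHom.comp_apply, RingHom.coe_coe, hψ]
      exact Ideal.mem_map_of_mem _ (hφ0 p hp)
    · rw [kc3Origin, Ideal.map_le_iff_le_comap]
      intro p hp
      rw [Ideal.mem_comap]
      have : Ideal.Quotient.mk (Ideal.span {kc3Poly k hP}) p = ψ (Ideal.Quotient.mk _ (φ.symm p)) := by
        rw [hψ, AlgEquiv.apply_symm_apply]
      rw [this]
      exact Ideal.mem_map_of_mem _ (Ideal.mem_map_of_mem _ (hφs0 p hp))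
  -- `L` as an `A′`-algebra through `ψ`, a localization at the origin of `A′`
  letI : Algebra (KC3Ring k hP) L := ((algebraMap (KC3RingXY k hP) L).comp ψ.symm.toRingHom).toAlgebra
  haveI hprime : (kc3Origin k hP).IsPrime := (kc3Origin_isMaximal (k := k) (hP := hP) h0).isPrime
  have hψsurj : Function.Surjective (ψ : KC3RingXY k hP →+* KC3Ring k hP) := ψ.surjective
  have hM : ((kc3OriginXY k hP).primeCompl).map ψ = (kc3Origin k hP).primeCompl := by
    ext b
    rw [Submonoid.mem_map]
    constructor
    · rintro ⟨a, ha, rfl⟩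
      change a ∉ kc3OriginXY k hP at ha
      change ψ a ∉ kc3Origin k hP
      intro hb
      apply ha
      rw [← hO] at hb
      obtain ⟨a', ha', he⟩ := (Ideal.mem_map_iff_of_surjective _ hψsurj).mp hb
      rw [RingHom.coe_coe] at he
      rwa [← ψ.injective he]
    · intro hb
      change b ∉ kc3Origin k hP at hb
      refine ⟨ψ.symm b, fun ha => hb ?_, ψ.apply_symm_apply b⟩
      rw [← hO]
      have := Ideal.mem_map_of_mem (ψ : KC3RingXY k hP →+* KC3Ring k hP) ha
      rwa [RingHom.coe_coe, ψ.apply_symm_apply] at this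
  haveI : IsLocalization.AtPrime L (kc3Origin k hP) := by
    have hloc := IsLocalization.isLocalization_of_base_ringEquiv ((kc3OriginXY k hP).primeCompl) L
      (ψ : KC3RingXY k hP ≃+* KC3Ring k hP)
    rw [hM] at hloc
    exact hloc
  have key := span_le_cohomologyAnnihilator_of_isLocalization hE k hchar hP h0 hP0 hca L
  -- every generator of `A` is `φ⁻¹` of a polynomial; go through `φ`
  have hback : ∀ p : MvPolynomial (Fin 4) k,
      algebraMap (KC3RingXY k hP) L (Ideal.Quotient.mk _ p) = algebraMap (KC3Ring k hP) L (Ideal.Quotient.mk _ (φ p)) := by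
    intro p
    change _ = algebraMap (KC3RingXY k hP) L (ψ.symm (Ideal.Quotient.mk _ (φ p)))
    rw [hψs, AlgEquiv.symm_apply_apply]
  rw [Ideal.span_le]
  rintro x hx
  simp only [Set.mem_insert_iff, Set.mem_singleton_iff] at hx
  rw [SetLike.mem_coe]
  rcases hx with rfl | rfl | rfl | rfl | rfl
  · rw [hback, hφ, xyFwd_zero, map_add, map_mul, map_add, map_mul]
    exact Ideal.add_mem _ (key (Ideal.subset_span (by simp)))
      (Ideal.mul_mem_left _ _ (key (Ideal.subset_span (by simp))))
  · rw [hback, hφ, xyFwd_one, map_sub, map_mul, map_sub, map_mul]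
    exact Ideal.sub_mem _ (key (Ideal.subset_span (by simp)))
      (Ideal.mul_mem_left _ _ (key (Ideal.subset_span (by simp))))
  · rw [hback, map_pow, hφ, xyFwd_two]
    exact key (Ideal.subset_span (by simp))
  · rw [hback, map_mul, hφ, hφ, xyFwd_two, xyFwd_three]
    exact key (Ideal.subset_span (by simp))
  · rw [hback, map_pow, hφ, xyFwd_three]
    exact key (Ideal.subset_span (by simp))

end Summit.ResolutionOfSingularities.ResolutionOfSingularities.Theorems.HomologicalConductor.PersistenceKC3Completion

end
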